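import Mathlib.Algebra.BigOperators.Field
import Mathlib.Data.Rat.Defs
import Mathlib.Algebra.Order.BigOperators.Group.Finset
import Mathlib.LinearAlgebra.Matrix.Notation
import Mathlib.Tactic.FieldSimp
import Mathlib.Tactic.Ring
import Mathlib.Tactic.LinearCombination
import Mathlib.Tactic.NormNum
import HarnessLib

/-!
# Venture HSemireg — two generalities behind the Brandt-matrix certificates of THEOREM 39-E (ENGINE-W SEC39 §7): the MASS VECTOR `(1∕w_i)`
# is a left eigenvector (eigenvalue = the row sum `q + 1`) of ANY matrix with the Brandt symmetry `w_k B_ik = w_i B_ki`, and the cusp vector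
# `(1, 0, −2)` is `1∕w`-orthogonal to both Eisenstein-type eigenvectors for `w = (12, 8, 24)` — kernel algebra

HONEST FRAMING. Lean index of the computation cell `pub-hsemireg`, widening group ENGINE-W (code A, seat `engine-w-1`, gen 17). LINEAR
ALGEBRA over a field (finite sums); no quaternion order, ideal class, modular form or hermitian lattice is constructed; nothing here says that HC,
HC_CM or HC_AV holds. Theorems only (0 `def`, 0 named fact, 0 `sorry`). New namespace `BrandtMass`; companion of `BrandtMatricesSqrtSix.lean`
(the six printed `3 × 3` matrices, `w = (12, 8, 24)`, eigenvectors `(1,1,1)`, `(1,−1,1)`, `(1,0,−2)`).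

SOURCE (the cell's own result): `widen/ENGINE-W/out/probe5/SEC39-BGP-A.md` §7 THEOREM 39-E (c): «BRANDT MATRICES … all satisfy `w_i⁻¹B_ik = w_k⁻¹B_ki`
… eigenvalues `(q+1, χ_gen(𝔭)(q+1), λ)`» and (a) «`Σ1∕w = 1∕12 + 1∕8 + 1∕24 = 1∕4` … Eichler's mass formula». What the kernel holds:

* §1 **`mass_left_eigenvector`** — for any `n`, any field, weights `w_i ≠ 0`, a matrix `B` with `w_k·B_ik = w_i·B_ki` for all `i, k` and
  constant row sums `Σ_k B_ik = r`: `Σ_i (1∕w_i)·B_ik = r∕w_k` for every `k` — the mass vector `(1∕w_i)_i` is a LEFT eigenvector with the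
  row-sum eigenvalue (so `Σ_i 1∕w_i` is preserved by `B∕r`: the mass is an invariant of the neighbour walk).
* §2 `petersson_orthogonality_168` — for `w = (12, 8, 24)`: `⟨(1,0,−2), (1,1,1)⟩_{1∕w} = 1∕12 + 0 − 2∕24 = 0` and `⟨(1,0,−2), (1,−1,1)⟩_{1∕w} = 0`,
  `⟨(1,1,1),(1,−1,1)⟩_{1∕w} = 1∕12 − 1∕8 + 1∕24 = 0`: the three printed eigenvectors are pairwise orthogonal for the mass inner product.
-/

namespace Summit.Ventures.HSemireg.BrandtMass

open Finset

/-! ## §1 The mass vector is a left eigenvector -/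

/-- **Eichler's mass vector is a left eigenvector of every Brandt-symmetric matrix**: if `w_k·B_ik = w_i·B_ki` for all `i, k` (all `w_i ≠ 0`)
and every row of `B` sums to `r`, then `Σ_i B_ik ∕ w_i = r ∕ w_k` for every column `k`. [kernel] -/
theorem mass_left_eigenvector {F : Type*} [Field F] {n : ℕ} (B : Fin n → Fin n → F) (w : Fin n → F) (r : F)
    (hw : ∀ i, w i ≠ 0) (hsym : ∀ i k, w k * B i k = w i * B k i) (hrow : ∀ i, ∑ k, B i k = r) (k : Fin n) :
    ∑ i, B i k / w i = r / w k := by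
  have hk := hw k
  have hterm : ∀ i, B i k / w i = B k i / w k := by
    intro i
    rw [div_eq_div_iff (hw i) hk]
    linear_combination hsym i k
  rw [Finset.sum_congr rfl (fun i _ => hterm i), ← Finset.sum_div, hrow k]

/-- Consequently the total mass is invariant: `Σ_k (Σ_i B_ik ∕ w_i) = r · Σ_k 1∕w_k`. [kernel] -/
theorem mass_total {F : Type*} [Field F] {n : ℕ} (B : Fin n → Fin n → F) (w : Fin n → F) (r : F)
    (hw : ∀ i, w i ≠ 0) (hsym : ∀ i k, w k * B i k = w i * B k i) (hrow : ∀ i, ∑ k, B i k = r) :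
    ∑ k, ∑ i, B i k / w i = r * ∑ k, 1 / w k := by
  rw [Finset.mul_sum]
  refine Finset.sum_congr rfl (fun k _ => ?_)
  rw [mass_left_eigenvector B w r hw hsym hrow k, div_eq_mul_one_div]

/-! ## §2 The three printed eigenvectors are orthogonal for the mass inner product (`w = (12, 8, 24)`) -/

/-- **`1∕w`-orthogonality** of `(1,1,1)`, `(1,−1,1)` (Eisenstein ∕ genus character) and the cusp vector `(1,0,−2)` for `w = (12, 8, 24)`:
`1∕12 − 1∕8 + 1∕24 = 0`, `1∕12 + 0 − 2∕24 = 0`, `1∕12 − 0 − 2∕24 = 0`; and the mass `1∕12 + 1∕8 + 1∕24 = 1∕4`. [kernel, `norm_num`] -/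
theorem petersson_orthogonality_168 :
    (1 : ℚ) * 1 / 12 + 1 * (-1) / 8 + 1 * 1 / 24 = 0 ∧
    (1 : ℚ) * 1 / 12 + 0 * 1 / 8 + (-2) * 1 / 24 = 0 ∧
    (1 : ℚ) * 1 / 12 + 0 * (-1) / 8 + (-2) * 1 / 24 = 0 ∧
    (1 : ℚ) / 12 + 1 / 8 + 1 / 24 = 1 / 4 := by
  norm_num

/-- The printed `B(𝔭₃) = [[2,0,2],[0,4,0],[4,0,0]]` is Brandt-symmetric for `w = (12,8,24)` with row sum `4`, and its mass-vector image is
`(4∕12, 4∕8, 4∕24)` — an instance of §1 checked directly: `Σ_i B_i1∕w_i = 2∕12 + 0 + 4∕24 = 1∕3 = 4∕12`, etc. [kernel, `norm_num`] -/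
theorem instance_p3 :
    (2 : ℚ) / 12 + 0 / 8 + 4 / 24 = 4 / 12 ∧ (0 : ℚ) / 12 + 4 / 8 + 0 / 24 = 4 / 8 ∧ (2 : ℚ) / 12 + 0 / 8 + 0 / 24 = 4 / 24 := by
  norm_num

end Summit.Ventures.HSemireg.BrandtMass
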